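import Summits.BirchSwinnertonDyer.BirchSwinnertonDyer.Theorems.ThetaPartnerAtTwoMazurTateCongruenceAtTwoTopOfIhara
import Literature.NumberTheory.EllipticCurves.IharaLemmaModTwoSymbolForm
import HarnessLib

/-!
# Crux `MazurTateCongruenceAtTwoTop` (stmt-BirchSwinnertonDyer-25797 = `MazurTateCongruenceAtTwoR` 21416), line `symbol` v6:
# THE CRUX BY NAME from SIX NAMED PRINT FACTS — the last input (IH₂⁻) stated as the named fact «Ihara's lemma mod `2`, read on
# Manin-symbol functions» (lead prover bsd-wall-tp2-p1 g11; `--supports stmt-BirchSwinnertonDyer-25797`; closes nothing)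

HONEST FRAMING. The named facts are `def … : Prop` HYPOTHESES (cite_only, nothing asserted); the sixth,
`Literature.NumberTheory.EllipticCurves.ribet1984_ihara_modTwo_symbolForm` (typed by this seat, `Literature/…/IharaLemmaModTwoSymbolForm.lean`), is an ASSEMBLED READING of Ihara's lemma (Ihara 1975 Lemma 3.2 / Ribet, ICM 1983, Thm. 4.1–4.3, «for all
primes `l`», cf. Manning–Shotton, Math. Ann. 2020, Thm. «Ihara's Lemma» p. 2: for `Γ = Γ₀(N)`, `p ∤ N` and ANY prime `l`,
`π₁* + π₂* : H¹(X_Γ, 𝔽_l)² → H¹(X_{Γ∩Γ₀(p)}, 𝔽_l)` is injective after localising at a non-Eisenstein maximal ideal) on `1`-periodic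
Manin-symbol functions `ℚ → ℚ̄₂` — see its docstring for the assembly steps, which are NOT verbatim in print (the translation to symbol
functions, the `ℓ ∣ N'` case, Serre's congruence-subgroup property and a Chebotarev step). BSD is not proved by any of this.

WHAT. `mazurTateCongruenceAtTwoTop_of_sixFacts (hES hSD hBz hSe hAU hIh) : MazurTateCongruenceAtTwoTop` — the crux BY NAME from
Eichler–Shimura (depleted optimal quotient), Hecke self-duality of `J₀[ℓ]`, Buzzard's mod-`2` multiplicity one, Serre 1972 Prop. 12,
Abbes–Ullmo Thm. A, and Ihara's lemma mod `2` (symbol form) — by `mazurTateCongruenceAtTwoTop_of_fiveFacts_ihara` (p631190); the twin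
21416; and `muInvarianceAtTwo_of_sixFacts`: Greenberg–Vatsal `μ`-invariance at `2` on the theta habitat from the same six facts.

References: [Ribet1984ICM] Thm. 4.1–4.3; [Serre1970SL2] Thm. 2; [Manin1972] Thm. 1.9; [GreenbergVatsal2000] Thm. (1.4), §3 (13), Rem. 3.4;
[Vatsal1999] Thm. (1.10); [Buzzard2000LevelLoweringModTwo] Prop. 2.4; [AbbesUllmo1996] Thm. A; [Diamond1991CongruencePrimes] Thm. 2.
-/

-- justification: the `Summit.BirchSwinnertonDyer.BirchSwinnertonDyer.…` path repeats a component (route-file convention)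
set_option linter.dupNamespace false
set_option autoImplicit false

noncomputable section

open scoped Classical MatrixGroups ModularForm

open CongruenceSubgroup Polynomial WeierstrassCurve NumberField IsDedekindDomain
  Literature.NumberTheory.IwasawaTheory Literature.NumberTheory.EllipticCurves Literature.NumberTheory.EllipticCurves.ModularForms
  Literature.NumberTheory.EllipticCurves.Rank1Residual Literature.NumberTheory.EllipticCurves.GreenbergVatsal2000
  Summit.BirchSwinnertonDyer.Rank1Residual.Supersingular
  Summit.BirchSwinnertonDyer.BirchSwinnertonDyer.Theorems.ThetaLayerLambdaCongruenceAtTwo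

namespace Summit.BirchSwinnertonDyer.BirchSwinnertonDyer.Theorems.MazurTateCongruenceAtTwoR

/-- **`MazurTateCongruenceAtTwoTop` (crux stmt-25797 = 21416) BY NAME from SIX named print facts**: Eichler–Shimura for the depleted optimal
quotient, Hecke self-duality of `J₀(N)[ℓ]`, Buzzard's mod-`2` multiplicity one, Serre 1972 Prop. 12, Abbes–Ullmo Thm. A, and Ihara's lemma
mod `2` in symbol form (`ribet1984_ihara_modTwo_symbolForm`). One line over `mazurTateCongruenceAtTwoTop_of_fiveFacts_ihara` (p631190). No `μ = 0` /
`μ`-invariance input. All six are HYPOTHESES (cite_only facts); BSD is not proved by this. [cite: Ribet1984ICM, Thm. 4.3]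
[cite: GreenbergVatsal2000, Thm. (1.4), §3 (13) and Remark 3.4] [cite: AbbesUllmo1996, Thm. A] [cite: Buzzard2000LevelLoweringModTwo, Prop. 2.4] -/
theorem mazurTateCongruenceAtTwoTop_of_sixFacts
    (hES : eichlerShimura_depletedOptimalQuotient_periodLattice_of_dvd) (hSD : heckeSelfDual_torsionBy_J0)
    (hBz : buzzard2000_multiplicityOne_gamma0) (hSe : serre1972_supersingular_decompositionSubgroup_image)
    (hAU : abbesUllmo_not_dvd_maninConstant_of_not_dvd_level) (hIh : ribet1984_ihara_modTwo_symbolForm) :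
    Summit.BirchSwinnertonDyer.BirchSwinnertonDyer.Theses.ThetaPartnerAtTwo.MazurTateCongruenceAtTwoTop :=
  mazurTateCongruenceAtTwoTop_of_fiveFacts_ihara hES hSD hBz hSe hAU hIh

/-- The twin `MazurTateCongruenceAtTwoR` (stmt-21416) BY NAME from the same six named facts. BSD is not proved by this.
[cite: Ribet1984ICM, Thm. 4.3] [cite: GreenbergVatsal2000, §3 (13)] -/
theorem mazurTateCongruenceAtTwoR_of_sixFacts
    (hES : eichlerShimura_depletedOptimalQuotient_periodLattice_of_dvd) (hSD : heckeSelfDual_torsionBy_J0)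
    (hBz : buzzard2000_multiplicityOne_gamma0) (hSe : serre1972_supersingular_decompositionSubgroup_image)
    (hAU : abbesUllmo_not_dvd_maninConstant_of_not_dvd_level) (hIh : ribet1984_ihara_modTwo_symbolForm) :
    Summit.BirchSwinnertonDyer.BirchSwinnertonDyer.Theses.ThetaPartnerAtTwo.MazurTateCongruenceAtTwoR :=
  mazurTateCongruenceAtTwoTop_of_sixFacts hES hSD hBz hSe hAU hIh

/-- **Greenberg–Vatsal `μ`-invariance at `2` on the theta habitat from the six named facts**: for every theta pair, newforms and Pollack pairs
at `2`, `L♭_W` has a unit coefficient iff `L♭_A` does (`muInvarianceAtTwo_of_fourFacts_ihara` with the period fact from Abbes–Ullmo).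
BSD is not proved by this. [cite: GreenbergVatsal2000, Thm. (1.4)] [cite: Ribet1984ICM, Thm. 4.3] [cite: AbbesUllmo1996, Thm. A] -/
theorem muInvarianceAtTwo_of_sixFacts
    (hES : eichlerShimura_depletedOptimalQuotient_periodLattice_of_dvd) (hSD : heckeSelfDual_torsionBy_J0)
    (hBz : buzzard2000_multiplicityOne_gamma0) (hSe : serre1972_supersingular_decompositionSubgroup_image)
    (hAU : abbesUllmo_not_dvd_maninConstant_of_not_dvd_level) (hIh : ribet1984_ihara_modTwo_symbolForm) :
    ∀ (W : WeierstrassCurve ℚ) [W.IsElliptic] [W.IsGloballyMinimal] (A : WeierstrassCurve ℚ) [A.IsElliptic]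
      [A.IsGloballyMinimal], ¬ W.HasCM → W.analyticRank = 0 → GoodSS W 2 → W.frobeniusTrace 2 = 0 → A.HasCM → GoodSS A 2 →
      A.frobeniusTrace 2 = 0 →
      (∃ e : geomTorsion W (2 : ℤ) ≃+ geomTorsion A (2 : ℤ),
        ∀ (σ : Field.absoluteGaloisGroup ℚ) (P : geomTorsion W (2 : ℤ)), e (σ • P) = σ • e P) →
      ∀ [NeZero (W.conductorNorm ℤ)] (f : CuspForm (Gamma0 (W.conductorNorm ℤ)) 2), IsNewformOf W f →
      ∀ (Lplus Lminus : IwasawaAlgebra 2), IsPollackPair f 2 Lplus Lminus →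
      ∀ [NeZero (A.conductorNorm ℤ)] (fA : CuspForm (Gamma0 (A.conductorNorm ℤ)) 2), IsNewformOf A fA →
      ∀ (LplusA LminusA : IwasawaAlgebra 2), IsPollackPair fA 2 LplusA LminusA →
      ((∃ n : ℕ, IsUnit (PowerSeries.coeff n (kobayashiL 1 Lplus Lminus))) ↔
        (∃ n : ℕ, IsUnit (PowerSeries.coeff n (kobayashiL 1 LplusA LminusA)))) :=
  muInvarianceAtTwo_of_fourFacts_ihara hES hSD hBz hSe (SkinnerUrban2014.realPeriodRat_eq_unit_mul_plusPeriod_two_fact_of_abbesUllmo hAU) hIh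

end Summit.BirchSwinnertonDyer.BirchSwinnertonDyer.Theorems.MazurTateCongruenceAtTwoR

end
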